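import Mathlib
import Summits.NavierStokesRegularity.NavierStokesRegularity.Theorems.EulerZoomLiouvillePowerGaugeEulerLiouvilleNeedleCasimirClock
import Summits.NavierStokesRegularity.NavierStokesRegularity.Theorems.EulerZoomLiouvillePowerGaugeEulerLiouvilleNeedleAxisymBand
import Literature.Analysis.FluidPDE.KNSSTypeIRateVertexCylinder
import HarnessLib.Audit

/-!
# Crux E `EulerZoomLiouville.PowerGaugeEulerLiouville` — the needle stratum: NO VORTICAL RECURRENCE for an axisymmetric
# swirl-free self-similar profile (part 2/2 of nsreg-p2 g32's ROUND-37 plate t38c «Casimir clock in Cauchy form»)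

Route №10 `EulerZoomLiouville` (NavierStokesRegularity), crux E = stmt-NavierStokesRegularity-19832, memo ROUND-37 of the cell
`ns-regularity-ideate` (author nsreg-p2 g32; plate `HOME/ns-regularity-ideate-p2/t38c-casimir-clock-plate/…NeedleCasimirClock.lean` v2,
sha16 ef9d145921e7d3e3, 549 l.).  The plate exceeds the 400-line rule for Theorems files, so it is landed VERBATIM AS TWO FILES in the same namespace
`…Theorems.PowerGaugeEulerLiouville.NeedleCasimirClock`, every declaration byte-identical (keyed FIRE by ns-ezl-w7 g0): part 1/2
`…NeedleCasimirClock.lean` = the plate's §§ «axisymmetry of the transport field», «the clock», «norm forms» with the author's module docstring; THIS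
FILE = part 2/2, the plate's § «no vortical recurrence» (v2 addition, qualitative, no budgets): `abs_horizontal_le_mul_cylRadius` (|W y 0|, |W y 1| ≤
K·cylRadius y on a ball for axisymmetric `W`), `cylRadius_pos_of_backwardOrbit` (backward orbits starting off the axis stay off it),
`curl_eq_zero_of_recurrent_backwardOrbit` (a backward similarity orbit that returns to a fixed ball at arbitrarily late times carries no vorticity —
the Casimir clock `‖curl V (Y t)‖ = |ξ₀| e^{(1+γ)t} cylRadius (Y t)` against continuity of `curl V` on the ball), `curl_eq_zero_of_bounded_backwardOrbit`,
`tendsto_norm_atTop_of_curl_ne_zero` (Ω(Y 0) ≠ 0 ⇒ ‖Y t‖ → ∞), `curl_eq_zero_of_stagnation` (W z = 0 ⇒ curl V z = 0).  Gate dedup (the only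
edits to the author's text): the plate's coordinate helpers `abs_apply_le_norm`, `abs_apply_zero_le_cylRadius`, `abs_apply_one_le_cylRadius` are the
tree's `NeedleAxisymBand.abs_apply_le_norm` (plate t38a) and `Literature.Analysis.FluidPDE.abs_apply_{zero,one}_le_cylRadius` (…KNSSTypeIRateVertexCylinder).

WHAT THIS IS NOT: not NS, not E — a profile-level helper plate for the needle stratum of the crux CLASS 19832 (ROUND-37 text-to-Lean), helper credit
only; 19832 OPEN. [cite: ConstantinIgnatovaVicol2026Putative, §3.4.1 eq. (3.22); KochNadirashviliSereginSverak2009, Remark 5.1]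
-/

set_option linter.dupNamespace false

open Set Filter Topology
open Literature.Analysis Literature.Analysis.FluidPDE
open Summit.NavierStokesRegularity.NavierStokesRegularity.Theorems.PowerGaugeEulerLiouville

namespace Summit.NavierStokesRegularity.NavierStokesRegularity.Theorems.PowerGaugeEulerLiouville.NeedleCasimirClock

variable {γ : ℝ} {V : (EuclideanSpace ℝ (Fin 3)) → (EuclideanSpace ℝ (Fin 3))}
  {P : (EuclideanSpace ℝ (Fin 3)) → ℝ}


/-! ### No vortical recurrence: backward orbits carrying vorticity escape to infinity -/

/-- The axial projection `p(y) = (0, 0, y₂)` is at distance `r⊥(y)` from `y`. [folklore] -/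
theorem norm_sub_axisProj_eq_cylRadius (y : EuclideanSpace ℝ (Fin 3)) :
    ‖y - EuclideanSpace.single 2 (y 2)‖ = cylRadius y := by
  rw [EuclideanSpace.norm_eq, cylRadius, Fin.sum_univ_three]
  congr 1
  simp [Real.norm_eq_abs, sq_abs]

/-- `‖p(y)‖ ≤ ‖y‖` for the axial projection. [folklore] -/
theorem norm_axisProj_le (y : EuclideanSpace ℝ (Fin 3)) :
    ‖EuclideanSpace.single (2 : Fin 3) (y 2)‖ ≤ ‖y‖ := by
  rw [PiLp.norm_single, Real.norm_eq_abs]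
  exact NeedleAxisymBand.abs_apply_le_norm y 2

/-- **Horizontal Lipschitz bound at the axis.** For an axisymmetric differentiable field `W` with
`‖DW‖ ≤ K` on the ball `‖y‖ ≤ R`: `|W(y)₀|, |W(y)₁| ≤ K r⊥(y)` for `‖y‖ ≤ R` (the horizontal
velocity vanishes on the axis, `IsAxisymmetric.apply_zero_eq_zero_of_axis`, and the mean value
inequality on the segment to the axial projection). [folklore] -/
theorem abs_horizontal_le_mul_cylRadius
    {W : (EuclideanSpace ℝ (Fin 3)) → (EuclideanSpace ℝ (Fin 3))}
    (hW : IsAxisymmetric W) (hWd : Differentiable ℝ W) {R K : ℝ}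
    (hK : ∀ y ∈ Metric.closedBall (0 : EuclideanSpace ℝ (Fin 3)) R, ‖fderiv ℝ W y‖ ≤ K)
    {y : EuclideanSpace ℝ (Fin 3)} (hy : y ∈ Metric.closedBall (0 : EuclideanSpace ℝ (Fin 3)) R) :
    |W y 0| ≤ K * cylRadius y ∧ |W y 1| ≤ K * cylRadius y := by
  set p : EuclideanSpace ℝ (Fin 3) := EuclideanSpace.single 2 (y 2) with hp
  have hp0 : p 0 = 0 := by simp [hp]
  have hp1 : p 1 = 0 := by simp [hp]
  have hpR : p ∈ Metric.closedBall (0 : EuclideanSpace ℝ (Fin 3)) R := by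
    rw [mem_closedBall_zero_iff] at hy ⊢
    exact (norm_axisProj_le y).trans hy
  have hmvt : ‖W y - W p‖ ≤ K * ‖y - p‖ :=
    Convex.norm_image_sub_le_of_norm_fderiv_le (fun x _ => hWd x) hK (convex_closedBall 0 R) hpR hy
  rw [norm_sub_axisProj_eq_cylRadius] at hmvt
  have hW0 : W p 0 = 0 := IsAxisymmetric.apply_zero_eq_zero_of_axis hW hWd hp0 hp1
  have hW1 : W p 1 = 0 := IsAxisymmetric.apply_one_eq_zero_of_axis hW hWd hp0 hp1
  have h0 : |W y 0| ≤ ‖W y - W p‖ := by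
    have := NeedleAxisymBand.abs_apply_le_norm (W y - W p) 0
    simpa [hW0] using this
  have h1 : |W y 1| ≤ ‖W y - W p‖ := by
    have := NeedleAxisymBand.abs_apply_le_norm (W y - W p) 1
    simpa [hW1] using this
  exact ⟨h0.trans hmvt, h1.trans hmvt⟩

/-- Derivative of a coordinate along a curve. [folklore] -/
theorem hasDerivAt_apply_comp {Y : ℝ → EuclideanSpace ℝ (Fin 3)} {Y' : EuclideanSpace ℝ (Fin 3)}
    {t : ℝ} (hY : HasDerivAt Y Y' t) (i : Fin 3) :
    HasDerivAt (fun s => Y s i) (Y' i) t := by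
  have h := (EuclideanSpace.proj (𝕜 := ℝ) i).hasFDerivAt.comp_hasDerivAt t hY
  simpa [Function.comp_def] using h

/-- **The axis is not reached in finite backward time.** Along a solution of `Y' = −W(Y)` on
`t ≥ 0`, `W` axisymmetric and `C¹`, starting off the axis, `r⊥(Y t) > 0` for every `t ≥ 0`:
`φ = r⊥(Y)²` satisfies `φ' ≥ −4Kφ` on each compact time interval (`abs_horizontal_le_mul_cylRadius`,
`K` a bound of `‖DW‖` on a ball containing the orbit segment), so `e^{4Kt}φ` does not decrease.
[folklore] -/
theorem cylRadius_pos_of_backwardOrbit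
    {W : (EuclideanSpace ℝ (Fin 3)) → (EuclideanSpace ℝ (Fin 3))}
    (hW : IsAxisymmetric W) (hWd : Differentiable ℝ W) (hWc : Continuous fun y => fderiv ℝ W y)
    {Y : ℝ → EuclideanSpace ℝ (Fin 3)}
    (hY : ∀ t, 0 ≤ t → HasDerivAt Y ((-1 : ℝ) • W (Y t)) t) (h0 : 0 < cylRadius (Y 0)) :
    ∀ t, 0 ≤ t → 0 < cylRadius (Y t) := by
  intro t₁ ht₁
  -- the orbit segment is bounded; `‖DW‖ ≤ K` on a ball containing it
  have hYc : ContinuousOn Y (Icc 0 t₁) := fun t ht => (hY t ht.1).continuousAt.continuousWithinAt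
  obtain ⟨R, hR⟩ : ∃ R, ∀ t ∈ Icc 0 t₁, ‖Y t‖ ≤ R := by
    obtain ⟨R, hR⟩ := (isCompact_Icc.image_of_continuousOn hYc).isBounded.exists_norm_le
    exact ⟨R, fun t ht => hR _ (mem_image_of_mem _ ht)⟩
  obtain ⟨K, hK⟩ : ∃ K, ∀ y ∈ Metric.closedBall (0 : EuclideanSpace ℝ (Fin 3)) R,
      ‖fderiv ℝ W y‖ ≤ K := by
    obtain ⟨K, hK⟩ :=
      ((isCompact_closedBall (0 : EuclideanSpace ℝ (Fin 3)) R).image hWc).isBounded.exists_norm_le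
    exact ⟨K, fun y hy => hK _ (mem_image_of_mem _ hy)⟩
  have hK0 : 0 ≤ K := (norm_nonneg _).trans
    (hK (Y 0) (mem_closedBall_zero_iff.2 (hR 0 (left_mem_Icc.2 ht₁))))
  -- `φ = r⊥(Y)²`, its derivative and the lower bound `φ' ≥ -4Kφ`
  set φ : ℝ → ℝ := fun s => Y s 0 ^ 2 + Y s 1 ^ 2 with hφ
  set dφ : ℝ → ℝ := fun t =>
    2 * Y t 0 * (((-1 : ℝ) • W (Y t)) 0) + 2 * Y t 1 * (((-1 : ℝ) • W (Y t)) 1) with hdφ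
  have hφ' : ∀ t, 0 ≤ t → HasDerivAt φ (dφ t) t := by
    intro t ht
    have e0 := hasDerivAt_apply_comp (hY t ht) 0
    have e1 := hasDerivAt_apply_comp (hY t ht) 1
    have := (e0.pow 2).add (e1.pow 2)
    refine this.congr_deriv ?_
    simp only [hdφ, Nat.cast_ofNat]
    ring
  have hφlow : ∀ t ∈ Icc 0 t₁, -(4 * K) * φ t ≤ dφ t := by
    intro t ht
    have hyR : Y t ∈ Metric.closedBall (0 : EuclideanSpace ℝ (Fin 3)) R :=
      mem_closedBall_zero_iff.2 (hR t ht)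
    obtain ⟨hw0, hw1⟩ := abs_horizontal_le_mul_cylRadius hW hWd hK hyR
    have hy0 := abs_apply_zero_le_cylRadius (Y t)
    have hy1 := abs_apply_one_le_cylRadius (Y t)
    have hr2 : φ t = cylRadius (Y t) ^ 2 := (cylRadius_sq (Y t)).symm
    have hprod0 : |Y t 0 * W (Y t) 0| ≤ cylRadius (Y t) * (K * cylRadius (Y t)) := by
      rw [abs_mul]; exact mul_le_mul hy0 hw0 (abs_nonneg _) (cylRadius_nonneg _)
    have hprod1 : |Y t 1 * W (Y t) 1| ≤ cylRadius (Y t) * (K * cylRadius (Y t)) := by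
      rw [abs_mul]; exact mul_le_mul hy1 hw1 (abs_nonneg _) (cylRadius_nonneg _)
    have e0 := (abs_le.1 hprod0).2
    have e1 := (abs_le.1 hprod1).2
    simp only [hdφ, PiLp.smul_apply, smul_eq_mul, neg_mul, one_mul]
    rw [hr2]
    nlinarith [e0, e1]
  -- `g = e^{4Kt} φ` is non-decreasing on `[0, t₁]`
  set g : ℝ → ℝ := fun s => Real.exp (4 * K * s) * φ s with hg
  have hg' : ∀ t ∈ Icc 0 t₁, HasDerivAt g
      (Real.exp (4 * K * t) * (4 * K * 1) * φ t + Real.exp (4 * K * t) * dφ t) t := by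
    intro t ht
    exact (((hasDerivAt_id t).const_mul (4 * K)).exp).mul (hφ' t ht.1)
  have hgmono : MonotoneOn g (Icc 0 t₁) := by
    refine monotoneOn_of_deriv_nonneg (convex_Icc 0 t₁)
      (fun t ht => (hg' t ht).continuousAt.continuousWithinAt)
      (fun t ht => ((hg' t (interior_subset ht)).differentiableAt).differentiableWithinAt) ?_
    intro t ht
    have ht' : t ∈ Icc 0 t₁ := interior_subset ht
    rw [(hg' t ht').deriv]
    have hexp : 0 < Real.exp (4 * K * t) := Real.exp_pos _
    have hlow := hφlow t ht'
    have : 0 ≤ Real.exp (4 * K * t) * (4 * K * φ t + dφ t) :=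
      mul_nonneg hexp.le (by linarith)
    nlinarith [this]
  have hg0 : g 0 = cylRadius (Y 0) ^ 2 := by
    simp only [hg, hφ, mul_zero, Real.exp_zero, one_mul]
    exact (cylRadius_sq (Y 0)).symm
  have hmono := hgmono (left_mem_Icc.2 ht₁) (right_mem_Icc.2 ht₁) ht₁
  rw [hg0] at hmono
  have h1 : 0 < Real.exp (4 * K * t₁) * φ t₁ := lt_of_lt_of_le (pow_pos h0 2) hmono
  have hφpos : 0 < φ t₁ := (mul_pos_iff_of_pos_left (Real.exp_pos _)).1 h1
  have hφeq : φ t₁ = cylRadius (Y t₁) ^ 2 := (cylRadius_sq (Y t₁)).symm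
  rw [hφeq] at hφpos
  rcases (cylRadius_nonneg (Y t₁)).eq_or_lt with hzero | hlt
  · rw [← hzero] at hφpos; norm_num at hφpos
  · exact hlt

/-- **NO VORTICAL RECURRENCE.**  For a `C²` axisymmetric swirl-free self-similar Euler profile
(`1 + γ > 0`), a backward similarity orbit `Y' = −W(Y)`, `t ≥ 0`, which RETURNS to a fixed ball
`‖y‖ ≤ R` at arbitrarily late times carries no vorticity: `Ω(Y 0) = 0`.  Mechanism: `ξ = ω_θ/r⊥`
is continuous (KNSS Remark 5.1, tree `contDiff_hadamardQuotFst_curl`), hence bounded by `M` on the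
ball, while the clock gives `|ξ(Y t)| = |ξ(Y 0)| e^{(1+γ)t}` as long as the orbit is off the axis —
and it stays off the axis (`cylRadius_pos_of_backwardOrbit`); a return at a time `t` with
`e^{(1+γ)t} |ξ(Y 0)| > M` is impossible.  In particular every bounded backward orbit, every
stagnation point, periodic orbit and compact backward-invariant set of `W` is irrotational
(`curl_eq_zero_of_bounded_backwardOrbit`), and an orbit through a vortical point escapes:
`‖Y t‖ → ∞` (`tendsto_norm_atTop_of_curl_ne_zero`). [cite: ConstantinIgnatovaVicol2026Putative, §3.4.1 eq. (3.22); KochNadirashviliSereginSverak2009, Remark 5.1] -/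
theorem curl_eq_zero_of_recurrent_backwardOrbit (h : IsSelfSimilarEulerProfile γ 0 V P)
    (hγ : 0 < 1 + γ) (hax : IsAxisymmetric V) (hsw : HasNoSwirl V)
    {Y : ℝ → EuclideanSpace ℝ (Fin 3)}
    (hY : ∀ t, 0 ≤ t → HasDerivAt Y ((-1 : ℝ) • selfSimilarTransport γ 0 V (Y t)) t)
    {R : ℝ} (hR : ∀ t, 0 ≤ t → ∃ s, t ≤ s ∧ ‖Y s‖ ≤ R) :
    curl V (Y 0) = 0 := by
  obtain ⟨ξ₀, h0⟩ := exists_curl_eq_smul_rotGen hax hsw h.contDiff_velocity (Y 0)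
  -- on the axis there is nothing to prove
  rcases (cylRadius_nonneg (Y 0)).eq_or_lt with hax0 | hpos
  · have hrot : rotGen (Y 0) = 0 := by
      rw [← norm_eq_zero, norm_rotGen_eq_cylRadius']; exact hax0.symm
    rw [h0, hrot, smul_zero]
  by_cases hξ : ξ₀ = 0
  · rw [h0, hξ, zero_smul]
  exfalso
  have hξpos : 0 < |ξ₀| := abs_pos.2 hξ
  -- `ξ = ω_θ / r⊥` is continuous, hence bounded by `M` on the ball
  set ξ : EuclideanSpace ℝ (Fin 3) → ℝ := hadamardQuotFst fun y => curl V y 1 with hξdef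
  have hξc : Continuous ξ :=
    (contDiff_hadamardQuotFst_curl (n := 0) (by exact_mod_cast h.contDiff_velocity)).continuous
  obtain ⟨M, hM⟩ : ∃ M, ∀ y ∈ Metric.closedBall (0 : EuclideanSpace ℝ (Fin 3)) R, |ξ y| ≤ M := by
    obtain ⟨M, hM⟩ :=
      ((isCompact_closedBall (0 : EuclideanSpace ℝ (Fin 3)) R).image hξc).isBounded.exists_norm_le
    exact ⟨M, fun y hy => (Real.norm_eq_abs _).symm.trans_le (hM _ (mem_image_of_mem _ hy))⟩
  obtain ⟨s₁, hs₁, hs₁R⟩ := hR 0 le_rfl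
  have hM0 : 0 ≤ M := (abs_nonneg _).trans (hM (Y s₁) (mem_closedBall_zero_iff.2 hs₁R))
  -- the orbit stays off the axis
  have hWax := isAxisymmetric_selfSimilarTransport hax γ
  have hWd := differentiable_selfSimilarTransport h.differentiable_velocity γ 0
  have hWc := NodalFiniteness.continuous_fderiv_transport h
  have hrpos := cylRadius_pos_of_backwardOrbit hWax hWd hWc hY hpos
  -- a late return time `s`
  set t₀ : ℝ := (M / |ξ₀| + 1) / (1 + γ) with ht₀
  have ht₀0 : 0 ≤ t₀ := by positivity
  obtain ⟨s, hts, hsR⟩ := hR t₀ ht₀0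
  have hs0 : 0 ≤ s := ht₀0.trans hts
  -- the clock and the structure identity at time `s`
  have hclock := norm_curl_comp_eq h hax hsw hs0 (fun t ht => hY t ht.1) h0 s ⟨hs0, le_rfl⟩
  have hstr : curl V (Y s) = ξ (Y s) • rotGen (Y s) :=
    curl_eq_hadamardQuotFst_smul_rotGen hax hsw h.contDiff_velocity (Y s)
  have hn : ‖curl V (Y s)‖ = |ξ (Y s)| * cylRadius (Y s) := by
    rw [hstr, norm_smul, Real.norm_eq_abs, norm_rotGen_eq_cylRadius']
  have hr := hrpos s hs0
  have hle : |ξ₀| * Real.exp ((1 + γ) * s) ≤ M := by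
    have e : |ξ₀| * Real.exp ((1 + γ) * s) * cylRadius (Y s) = |ξ (Y s)| * cylRadius (Y s) := by
      rw [← hclock, hn]
    have e' := mul_right_cancel₀ hr.ne' e
    rw [e']
    exact hM (Y s) (mem_closedBall_zero_iff.2 hsR)
  -- but `e^{(1+γ)s} ≥ e^{M/|ξ₀| + 1} > M/|ξ₀| + 1`
  have hexp : M / |ξ₀| + 1 < Real.exp ((1 + γ) * s) := by
    have h1 : (1 + γ) * t₀ = M / |ξ₀| + 1 := by
      rw [ht₀]; field_simp
    have h2 : (1 + γ) * t₀ ≤ (1 + γ) * s := mul_le_mul_of_nonneg_left hts hγ.le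
    calc M / |ξ₀| + 1 < M / |ξ₀| + 1 + 1 := by linarith
      _ ≤ Real.exp (M / |ξ₀| + 1) := Real.add_one_le_exp _
      _ ≤ Real.exp ((1 + γ) * s) := by rw [← h1]; exact Real.exp_le_exp.2 h2
  have hlt : M < |ξ₀| * Real.exp ((1 + γ) * s) := by
    have h3 := mul_lt_mul_of_pos_left hexp hξpos
    have h4 : |ξ₀| * (M / |ξ₀| + 1) = M + |ξ₀| := by field_simp
    rw [h4] at h3
    linarith
  linarith

/-- **Bounded backward orbits are irrotational** (in particular stagnation points, periodic orbits
and compact backward-invariant sets of `W`). [cite: ConstantinIgnatovaVicol2026Putative, §3.4.1 eq. (3.22)] -/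
theorem curl_eq_zero_of_bounded_backwardOrbit (h : IsSelfSimilarEulerProfile γ 0 V P)
    (hγ : 0 < 1 + γ) (hax : IsAxisymmetric V) (hsw : HasNoSwirl V)
    {Y : ℝ → EuclideanSpace ℝ (Fin 3)}
    (hY : ∀ t, 0 ≤ t → HasDerivAt Y ((-1 : ℝ) • selfSimilarTransport γ 0 V (Y t)) t)
    {R : ℝ} (hR : ∀ t, 0 ≤ t → ‖Y t‖ ≤ R) :
    curl V (Y 0) = 0 :=
  curl_eq_zero_of_recurrent_backwardOrbit h hγ hax hsw hY (fun t ht => ⟨t, le_rfl, hR t ht⟩)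

/-- **Vortical backward orbits escape to infinity**: if `Ω(Y 0) ≠ 0` then `‖Y t‖ → ∞` as the
backward similarity time `t → ∞`. [cite: ConstantinIgnatovaVicol2026Putative, §3.4.1 eq. (3.22)] -/
theorem tendsto_norm_atTop_of_curl_ne_zero (h : IsSelfSimilarEulerProfile γ 0 V P)
    (hγ : 0 < 1 + γ) (hax : IsAxisymmetric V) (hsw : HasNoSwirl V)
    {Y : ℝ → EuclideanSpace ℝ (Fin 3)}
    (hY : ∀ t, 0 ≤ t → HasDerivAt Y ((-1 : ℝ) • selfSimilarTransport γ 0 V (Y t)) t)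
    (hΩ : curl V (Y 0) ≠ 0) :
    Tendsto (fun t => ‖Y t‖) atTop atTop := by
  refine tendsto_atTop_atTop.2 fun R => ?_
  by_contra hcon
  push Not at hcon
  apply hΩ
  refine curl_eq_zero_of_recurrent_backwardOrbit h hγ hax hsw hY (R := R) fun t ht => ?_
  obtain ⟨s, hts, hsR⟩ := hcon (max t 0)
  exact ⟨s, (le_max_left _ _).trans hts, hsR.le⟩

/-- **A stagnation point of `W` off the axis… is impossible for vorticity; at any stagnation point
`Ω = 0`** (constant orbit). [cite: ConstantinIgnatovaVicol2026Putative, §3.4.1 eq. (3.22)] -/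
theorem curl_eq_zero_of_stagnation (h : IsSelfSimilarEulerProfile γ 0 V P)
    (hγ : 0 < 1 + γ) (hax : IsAxisymmetric V) (hsw : HasNoSwirl V)
    {z : EuclideanSpace ℝ (Fin 3)} (hz : selfSimilarTransport γ 0 V z = 0) :
    curl V z = 0 := by
  have hY : ∀ t : ℝ, 0 ≤ t →
      HasDerivAt (fun _ : ℝ => z) ((-1 : ℝ) • selfSimilarTransport γ 0 V z) t := by
    intro t _
    rw [hz, smul_zero]
    exact hasDerivAt_const t z
  exact curl_eq_zero_of_bounded_backwardOrbit h hγ hax hsw hY (R := ‖z‖) fun _ _ => le_rfl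

end Summit.NavierStokesRegularity.NavierStokesRegularity.Theorems.PowerGaugeEulerLiouville.NeedleCasimirClock
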